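import Mathlib
import Summits.KontsevichZagierPeriods.KontsevichZagierPeriods.Theorems.SoloInformedPellAbelForm
import HarnessLib
import HarnessLib.Audit

/-!
# Abel's theorem for the third kind inside `P`, II — the band (s41)

THEOREM XXX, file II of three (file I = `SoloInformedPellAbelForm`).  Measure-theoretic input
for the two Newton–Leibniz moves of file III, for an arbitrary Pell–Abel datum `P`:

* the constants `α = q₂/(q₂+nq₀)`, `β = n/(q₂+nq₀)` are algebraic;
* `ℚ`-semialgebraicity, on semialgebraic `S ⊆ {w | wᵢ ∈ (−1,1), wⱼ ∈ [0,1]}`, of the 2-form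
  `ψ(wᵢ, wⱼ)` and of both potentials `φ, Φ` (compositional: the datum's `A, B, R` are
  semialgebraic in each coordinate, algebraic constants, `√`, inverses of non-vanishing
  functions), and on `S ⊆ {w | −1 < w₁ ≤ 1, w₀ ∈ [0,1]}` of `ψ(w₁, w₀)`, `φ(w₁, w₀)` (the face
  `w₁ = 1`, where both vanish, glued on);
* absolute integrability of `ψ` on bands inside `(0,1) × [0,1]` in both coordinate orders, from
  the domination `|ψ| ≤ C(√(1−t))⁻¹` of file I.

References: M. Kontsevich, D. Zagier, *Periods* (2001), §1.1–1.2; J. Bochnak, M. Coste, M.-F. Roy,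
*Real algebraic geometry* (1998), §2.2; this work.
-/

noncomputable section

open MeasureTheory Set Filter
open scoped Classical

open Literature.NumberTheory.Transcendental Literature.NumberTheory.Transcendental.KZ
open Literature.ModelTheory.ExponentialFields

namespace Summit.KontsevichZagierPeriods.KontsevichZagierPeriods.Theorems

namespace SoloInformedPellAbel

variable (P : SoloInformedPellAbel)

/-! ### The constants are algebraic -/

/-- `α = q₂/(q₂+nq₀)` and `β = n/(q₂+nq₀)` are algebraic. [folklore] -/
theorem alpha_beta_isAlgebraic : IsAlgebraic ℚ P.alpha ∧ IsAlgebraic ℚ P.beta := by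
  have hn : P.n ∈ algebraicClosure ℚ ℝ := mem_algebraicClosure_iff.2 P.n_isAlgebraic
  have h0 : P.q₀ ∈ algebraicClosure ℚ ℝ := mem_algebraicClosure_iff.2 P.q₀_isAlgebraic
  have h2 : P.q₂ ∈ algebraicClosure ℚ ℝ := mem_algebraicClosure_iff.2 P.q₂_isAlgebraic
  refine ⟨mem_algebraicClosure_iff.1 ?_, mem_algebraicClosure_iff.1 ?_⟩
  · unfold alpha; apply_rules (transparency := .reducible) (maxDepth := 250) only
      [div_mem, mul_mem, add_mem, hn, h0, h2]
  · unfold beta; apply_rules (transparency := .reducible) (maxDepth := 250) only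
      [div_mem, mul_mem, add_mem, hn, h0, h2]

/-! ### Semialgebraicity: quadratic parts, kernel, the three functions -/

/-- `w ↦ c₀ + c₁ wᵢ²` is `ℚ`-semialgebraic for algebraic `c₀, c₁`. [folklore] -/
theorem sa_quad {S : Set (Fin 2 → ℝ)} (hS : IsSemialgebraic ℚ S) {c₀ c₁ : ℝ}
    (h₀ : IsAlgebraic ℚ c₀) (h₁ : IsAlgebraic ℚ c₁) (i : Fin 2) :
    IsSemialgebraicFunOn ℚ S (fun w => c₀ + c₁ * w i ^ 2) := by
  have ht : IsSemialgebraicFunOn ℚ S (fun w => w i) := isSemialgebraicFunOn_apply hS i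
  refine (IsSemialgebraicFunOn.add_holds (isSemialgebraicFunOn_const_of_isAlgebraic hS h₀)
    (IsSemialgebraicFunOn.mul_holds (isSemialgebraicFunOn_const_of_isAlgebraic hS h₁)
      (IsSemialgebraicFunOn.mul_holds ht ht))).congr fun w _ => ?_
  simp only [Pi.add_apply, Pi.mul_apply]
  ring

/-- The kernel `κ(wᵢ)` (modulus `m`) and `W(m, wᵢ)` are `ℚ`-semialgebraic on `S ⊆ {wᵢ ∈ (−1,1)}`.
[this work] -/
theorem sa_kernel {S : Set (Fin 2 → ℝ)} (hS : IsSemialgebraic ℚ S) {m : ℝ}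
    (hm : m ∈ Ioo (0:ℝ) 1) (hma : IsAlgebraic ℚ m) (i : Fin 2)
    (hi : ∀ w ∈ S, w i ∈ Ioo (-1:ℝ) 1) :
    IsSemialgebraicFunOn ℚ S (fun w => (√(1 - w i ^ 2))⁻¹ * (√(1 - m * w i ^ 2))⁻¹) ∧
    IsSemialgebraicFunOn ℚ S (fun w => soloInformedT4W m (w i)) := by
  have hr1 := sa_quad hS isAlgebraic_one isAlgebraic_one.neg i
  have hr2 := sa_quad hS isAlgebraic_one hma.neg i
  have hpos : ∀ w ∈ S, 0 < 1 - w i ^ 2 ∧ 0 < 1 - m * w i ^ 2 := fun w hw =>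
    soloInformed_kummerZeta_radicands_pos hm (by nlinarith [(hi w hw).1, (hi w hw).2])
  have hk1 := (IsSemialgebraicFunOn.sqrt_holds hr1).inv fun w hw => (Real.sqrt_pos.2 (by
    have := (hpos w hw).1; linarith)).ne'
  have hk2 := (IsSemialgebraicFunOn.sqrt_holds hr2).inv fun w hw => (Real.sqrt_pos.2 (by
    have := (hpos w hw).2; linarith)).ne'
  have hκ : IsSemialgebraicFunOn ℚ S (fun w => (√(1 - w i ^ 2))⁻¹ * (√(1 - m * w i ^ 2))⁻¹) := by
    refine (IsSemialgebraicFunOn.mul_holds hk1 hk2).congr fun w _ => ?_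
    simp only [Pi.mul_apply]
    ring_nf
  refine ⟨hκ, (IsSemialgebraicFunOn.mul_holds (IsSemialgebraicFunOn.mul_holds hr1 hr2) hκ).congr
    fun w _ => ?_⟩
  simp only [Pi.mul_apply, soloInformedT4W]
  ring_nf

/-- **Semialgebraicity of `ψ, φ, Φ`** in the coordinates `t = wᵢ ∈ (−1,1)`, `u = wⱼ ∈ [0,1]`.
[this work] -/
theorem sa_three {S : Set (Fin 2 → ℝ)} (hS : IsSemialgebraic ℚ S) (i j : Fin 2)
    (hi : ∀ w ∈ S, w i ∈ Ioo (-1:ℝ) 1) (hj : ∀ w ∈ S, w j ∈ Icc (0:ℝ) 1) :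
    IsSemialgebraicFunOn ℚ S (fun w => P.psi (w i) (w j)) ∧
    IsSemialgebraicFunOn ℚ S (fun w => P.phi (w i) (w j)) ∧
    IsSemialgebraicFunOn ℚ S (fun w => P.Phi (w i) (w j)) := by
  have hm := P.m_mem
  have hA := P.sa_A hS i
  have hB := P.sa_B hS i
  have hR := P.sa_R hS i
  have hQ := sa_quad hS P.q₀_isAlgebraic P.q₂_isAlgebraic i
  obtain ⟨hκ, hW⟩ := sa_kernel hS hm P.m_isAlgebraic i hi
  have hu : IsSemialgebraicFunOn ℚ S (fun w => w j) := isSemialgebraicFunOn_apply hS j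
  have h1 : IsSemialgebraicFunOn ℚ S (fun _ => (1:ℝ)) :=
    isSemialgebraicFunOn_const_of_isAlgebraic hS isAlgebraic_one
  have h2 : IsSemialgebraicFunOn ℚ S (fun _ => (2:ℝ)) :=
    isSemialgebraicFunOn_const_of_isAlgebraic hS (by exact_mod_cast isAlgebraic_nat (R := ℚ) (A := ℝ) 2)
  have hX := IsSemialgebraicFunOn.mul_holds hB hW
  have hv := IsSemialgebraicFunOn.sub_holds (IsSemialgebraicFunOn.mul_holds h2 hu) h1
  have hD : IsSemialgebraicFunOn ℚ S (fun w => P.A (w i) +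
      (2 * w j - 1) * (P.B (w i) * soloInformedT4W P.m (w i))) := by
    refine (IsSemialgebraicFunOn.add_holds hA (IsSemialgebraicFunOn.mul_holds hv hX)).congr
      fun w _ => ?_
    simp only [Pi.add_apply, Pi.mul_apply, Pi.sub_apply]
  have hAm : IsSemialgebraicFunOn ℚ S (fun w => P.A (w i) - P.B (w i) * soloInformedT4W P.m (w i)) := by
    refine (IsSemialgebraicFunOn.sub_holds hA hX).congr fun w _ => ?_
    simp only [Pi.mul_apply, Pi.sub_apply]
  have ht2 : ∀ w ∈ S, w i ^ 2 < 1 := fun w hw => by nlinarith [(hi w hw).1, (hi w hw).2]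
  have hDpos : ∀ w ∈ S, 0 < P.A (w i) +
      (2 * w j - 1) * (P.B (w i) * soloInformedT4W P.m (w i)) :=
    fun w hw => P.denom_pos (ht2 w hw) ⟨by linarith [(hj w hw).1], by linarith [(hj w hw).2]⟩
  have hAmpos : ∀ w ∈ S, 0 < P.A (w i) - P.B (w i) * soloInformedT4W P.m (w i) :=
    fun w hw => P.conj_pos (ht2 w hw).le
  have hNκ := IsSemialgebraicFunOn.mul_holds (IsSemialgebraicFunOn.mul_holds hQ hR) hκ
  refine ⟨(IsSemialgebraicFunOn.mul_holds hNκ ((IsSemialgebraicFunOn.mul_holds hD hD).inv fun w hw =>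
      (mul_pos (hDpos w hw) (hDpos w hw)).ne')).congr fun w _ => ?_,
    (IsSemialgebraicFunOn.mul_holds (IsSemialgebraicFunOn.mul_holds h2 hX) (hD.inv fun w hw =>
      (hDpos w hw).ne')).congr fun w _ => ?_,
    (IsSemialgebraicFunOn.mul_holds (IsSemialgebraicFunOn.mul_holds hu hNκ)
      ((IsSemialgebraicFunOn.mul_holds hAm hD).inv fun w hw =>
        (mul_pos (hAmpos w hw) (hDpos w hw)).ne')).congr fun w _ => ?_⟩
  · simp only [Pi.mul_apply, psi, div_eq_mul_inv, pow_two]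
  · simp only [Pi.mul_apply, phi, div_eq_mul_inv]
  · simp only [Pi.mul_apply, Phi, div_eq_mul_inv]

/-- **Kill coordinates with the face glued on**: `ψ(w₁, w₀)` and `φ(w₁, w₀)` are `ℚ`-semialgebraic
on `S ⊆ {−1 < w₁ ≤ 1, w₀ ∈ [0,1]}` (both vanish on `w₁ = 1`). [this work] -/
theorem sa_swap_face {S : Set (Fin 2 → ℝ)} (hS : IsSemialgebraic ℚ S)
    (hw : ∀ w ∈ S, (-1 < w 1 ∧ w 1 ≤ 1) ∧ w 0 ∈ Icc (0:ℝ) 1) :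
    IsSemialgebraicFunOn ℚ S (fun w => P.psi (w 1) (w 0)) ∧
    IsSemialgebraicFunOn ℚ S (fun w => P.phi (w 1) (w 0)) := by
  have hS' := hS.inter (isSemialgebraic_setOf_apply_lt_const (n := 2) isAlgebraic_one 1)
  obtain ⟨hP, hQ, -⟩ := P.sa_three hS' 1 0
    (fun w hw' => ⟨(hw w hw'.1).1.1, hw'.2⟩) fun w hw' => (hw w hw'.1).2
  exact ⟨soloInformed_kummerZeta_sa_face hS hP (fun w _ hw1 => by
      rw [hw1]; exact P.psi_right (w 0)) fun w hwS => (hw w hwS).1.2,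
    soloInformed_kummerZeta_sa_face hS hQ (fun w _ hw1 => by
      rw [hw1]; exact P.phi_right (w 0)) fun w hwS => (hw w hwS).1.2⟩

/-! ### Integrability of the 2-form on bands inside `(0,1) × [0,1]` -/

/-- `ψ(w₀, w₁)` is integrable on every semialgebraic `S ⊆ (0,1) × [0,1]` (deformation
coordinates: `t = w₀`, `u = w₁`). [this work] -/
theorem integrableOn_psi {S : Set (Fin 2 → ℝ)} (hS : IsSemialgebraic ℚ S)
    (hw : ∀ w ∈ S, w 0 ∈ Ioo (0:ℝ) 1 ∧ w 1 ∈ Icc (0:ℝ) 1) :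
    IntegrableOn (fun w : Fin 2 → ℝ => P.psi (w 0) (w 1)) S := by
  have hg := (P.sa_three hS 0 1
    (fun w hwS => ⟨by linarith [(hw w hwS).1.1], (hw w hwS).1.2⟩) fun w hwS => (hw w hwS).2).1
  obtain ⟨C, hC, hCle⟩ := P.exists_psi_abs_le
  refine soloInformed_integrableOn_of_le_inv_sqrt_prod hS hg ∅ {0} ∅ {0} C
    ({w | w 1 = 0} ∪ {w | w 1 = 1})
    (measure_union_null (by rw [volume_pi]; exact Measure.pi_hyperplane _ 1 0)
      (by rw [volume_pi]; exact Measure.pi_hyperplane _ 1 1))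
    (fun w hwS hZ j => ?_) (fun w _ hc => ?_)
  · simp only [mem_union, mem_setOf_eq, not_or] at hZ
    fin_cases j
    · exact (hw w hwS).1
    · exact ⟨lt_of_le_of_ne (hw w hwS).2.1 (Ne.symm hZ.1), lt_of_le_of_ne (hw w hwS).2.2 hZ.2⟩
  · have ha := hc 0
    have hb := hc 1
    have hK := hCle (w 0) ⟨ha.1.le, ha.2⟩ (w 1) ⟨hb.1.le, hb.2.le⟩
    have hX : 0 ≤ (√(1 - w 0))⁻¹ := by positivity
    rw [Finset.prod_empty, Finset.prod_singleton, one_mul]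
    calc |P.psi (w 0) (w 1)| ≤ C * (√(1 - w 0))⁻¹ := hK
      _ ≤ C * ((√(1 - w 0))⁻¹ + (√(1 - w 0))⁻¹) := by nlinarith [mul_nonneg hC hX]

/-- `ψ(w₁, w₀)` is integrable on every semialgebraic `S ⊆ (0,1) × [0,1]` (kill coordinates:
`u = w₀`, `t = w₁`). [this work] -/
theorem integrableOn_psi_swap {S : Set (Fin 2 → ℝ)} (hS : IsSemialgebraic ℚ S)
    (hw : ∀ w ∈ S, w 0 ∈ Ioo (0:ℝ) 1 ∧ w 1 ∈ Icc (0:ℝ) 1) :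
    IntegrableOn (fun w : Fin 2 → ℝ => P.psi (w 1) (w 0)) S := by
  have hg := (P.sa_swap_face hS fun w hwS =>
    ⟨⟨by linarith [(hw w hwS).2.1], (hw w hwS).2.2⟩, ⟨(hw w hwS).1.1.le, (hw w hwS).1.2.le⟩⟩).1
  obtain ⟨C, hC, hCle⟩ := P.exists_psi_abs_le
  refine soloInformed_integrableOn_of_le_inv_sqrt_prod hS hg ∅ {1} ∅ {1} C
    ({w | w 1 = 0} ∪ {w | w 1 = 1})
    (measure_union_null (by rw [volume_pi]; exact Measure.pi_hyperplane _ 1 0)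
      (by rw [volume_pi]; exact Measure.pi_hyperplane _ 1 1))
    (fun w hwS hZ j => ?_) (fun w _ hc => ?_)
  · simp only [mem_union, mem_setOf_eq, not_or] at hZ
    fin_cases j
    · exact (hw w hwS).1
    · exact ⟨lt_of_le_of_ne (hw w hwS).2.1 (Ne.symm hZ.1), lt_of_le_of_ne (hw w hwS).2.2 hZ.2⟩
  · have ha := hc 0
    have hb := hc 1
    have hK := hCle (w 1) ⟨hb.1.le, hb.2⟩ (w 0) ⟨ha.1.le, ha.2.le⟩
    have hX : 0 ≤ (√(1 - w 1))⁻¹ := by positivity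
    rw [Finset.prod_empty, Finset.prod_singleton, one_mul]
    calc |P.psi (w 1) (w 0)| ≤ C * (√(1 - w 1))⁻¹ := hK
      _ ≤ C * ((√(1 - w 1))⁻¹ + (√(1 - w 1))⁻¹) := by nlinarith [mul_nonneg hC hX]

end SoloInformedPellAbel

end Summit.KontsevichZagierPeriods.KontsevichZagierPeriods.Theorems

end
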